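import Literature.Probability.LatticeModels.CrossingUniqueness
import Literature.Probability.LatticeModels.BackboneChainRuleTwo
import Literature.Probability.LatticeModels.DepletedPairConnection
import HarnessLib

/-!
# The bounds on the events `F₁`–`F₄` (Aizenman–Duminil-Copin 2021, proof of Lemma 4.4 / 6.2)

Topic `Literature/Probability/LatticeModels`. In the proof of the intersection property

* M. Aizenman, H. Duminil-Copin, *Marginal triviality of the scaling limits of critical 4D Ising and
  `φ⁴₄` models*, Ann. of Math. **194** (2021), arXiv:1912.07973 [AizenmanDuminilCopinAnnals2021],
  Lemma 4.4 (p. 12; the same bounds serve for Lemma 6.2, p. 21),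

the four events `F₁,…,F₄` covering `{𝓜 ≠ ∅} ∖ I_k` (`CrossingUniqueness.lean`) are bounded as follows
(p. 12): "For `F₁` to occur, the backbone `Γ(n₁)` must do a zigzag: to go from `0` to a vertex
`v ∈ ∂Λ_n`, then to a vertex `w ∈ ∂Λ_{ℓ_k}`, and finally to `x`. The chain rule for backbones … jointly
imply that `P^{0x,∅}[F₁] ≤ ∑_{v ∈ ∂Λ_n, w ∈ ∂Λ_{ℓ_k}} ⟨σ₀σ_v⟩⟨σ_vσ_w⟩⟨σ_wσ_x⟩/⟨σ₀σ_x⟩ ≤ …`", and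
"To bound the probability of `F₂`, condition on `Γ(n₁)`. The remaining current in `n₁` is a sourceless
current with depleted coupling constants … The probability that some `v ∈ ∂Λ_n` and `w ∈ ∂Λ_m` are
connected in `ℤ⁴ ∖ Γ(n₁)` to each other can then be bounded by `⟨σ_vσ_w⟩⟨σ_vσ_w⟩'` … The Griffiths
inequality [Gri67] implies that this probability is bounded by `⟨σ_vσ_w⟩²`, which …, immediately
leads to … `P^{0x,∅}[F₂] ≤ ∑_{v ∈ ∂Λ_n, w ∈ ∂Λ_m} ⟨σ_vσ_w⟩² ≤ …`. The event `F₄` is bounded similarly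
to `F₁`, and `F₃` similarly to `F₂`."

This file proves the two displays (their first inequalities — the model-independent part) in the
tree's finite-volume current-sum language: a finite simple graph `G`, couplings `K ≥ 0`, an injective
ranking `rk` of the bonds driving the backbone exploration `Current.explore` from `u` with target `{y}`,
un-normalised sums in `ℝ≥0∞` with `Z[A] = ecurrentSum K A` (so `⟨σ_aσ_b⟩ = Z[{a}Δ{b}]/Z[∅]`, and
`P^{uy} ⊗ P^{∅}` has the weight `epairWeight K ({u}Δ{y}) ∅ / (Z[{u}Δ{y}] Z[∅])`):

* `Current.tsum_fOne_mul_le`, `Current.tsum_epairWeight_fOne_mul_le` — **the bound on `F₁`** (and, the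
  two definitions being the same with other radii, `Current.fFour_iff_fOne`, on `F₄`):
  `(∑ 1{∂n₁ = {u}Δ{y}} w(n₁) 𝟙[F₁]) · Z[∅]² ≤ ∑_{v ∈ S} ∑_{w ∈ S'} Z[{u}Δ{v}] Z[{v}Δ{w}] Z[{w}Δ{y}]`
  for any `S ⊇ {dist(u,·) = n₀}`, `S' ⊇ {dist(u,·) = a}` (`a ≤ n₀`): `F₁` ("at distance `≥ n₀`, later
  at distance `≤ a`", `Current.FOne`) forces the walk through the two spheres in this order
  (`Current.zigzag_spheres_of_return`), and the two-passage chain rule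
  `Current.tsum_backboneZigzag_mem_mul_le` applies.
* `Current.tsum_epairWeight_fBand_mul_le` — **the bound on `F₂` / `F₃`** (`Current.FBand … p q`):
  `(∑ 1{∂n₁ = {u}Δ{y}} 1{∂n₃ = ∅} w(n₁) w(n₃) 𝟙[F_band(p,q)]) · Z[∅] ≤ Z[{u}Δ{y}] · ∑_{v ∈ S_p} ∑_{w ∈ S_q} Z[{v}Δ{w}]²`,
  i.e. `P^{uy,∅}[F₂] ≤ ∑_{v,w} ⟨σ_vσ_w⟩²`, following the printed proof: condition on the backbone —
  the decomposition over the final states `δ` of the walk (`Current.tsum_mul_indicator_pos_eq_sum`; the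
  walk of a current with `∂n₁ = {u}Δ{y}` ends at `y`, `Current.explore_done_of_sources_eq`) and the
  weight factorisation `Current.tsum_sources_inCyl_mul_eq` (Aizenman 1982) turn the `n₁`-sum into
  `∑_δ ρ(δ) · (a sum over the sourceless currents of the depleted graph G ∖ used(δ))`
  (`Current.tsum_inCyl_crossInInd_eq`); on `F₂` the off-part plus `n₃` connects the two spheres through
  the depleted graph (`Current.connIn_of_avoidGraph_reachable`), an event of the pair (depleted
  sourceless current, full sourceless current) of mass `≤ ∑ ⟨σ_vσ_w⟩'⟨σ_vσ_w⟩ ≤ ∑ ⟨σ_vσ_w⟩²`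
  (`Current.tsum_isSupp_empty_empty_crossIn_mul_le`: the switching lemma with one depleted current,
  then Griffiths); finally `∑_δ ρ(δ) Z_{G ∖ used(δ)}[∅] = Z[{u}Δ{y}]`
  (`Current.sum_finalStates_patSum_mul_eq`).

No named fact is introduced; everything is proved.

## References

* M. Aizenman, H. Duminil-Copin, Ann. of Math. 194 (2021), arXiv:1912.07973, §4.2, proof of Lemma 4.4,
  the displays bounding `P^{0x,∅}[F₁]` and `P^{0x,∅}[F₂]` (p. 12); §6.1, proof of Lemma 6.2 (p. 21)
  [AizenmanDuminilCopinAnnals2021].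
* M. Aizenman, Comm. Math. Phys. 86 (1982), §9 (random-walk representation: Prop. 9.2, Lemma 9.2)
  [AizenmanCMP1982] — through `CurrentExplorationWeights.lean` and `BackboneChainRule(Two).lean`.
-/

noncomputable section

open Finset
open scoped symmDiff ENNReal

namespace Literature.Probability.LatticeModels

variable {V : Type*} [Fintype V] [DecidableEq V] {G : SimpleGraph V} [DecidableRel G.Adj]
  {K : G.edgeFinset → ℝ}

/-- **The depleted graph**: `G` with the bonds of `D` deleted ("`ℤ⁴ ∖ Γ(n₁)`" with the couplings of the
bonds used by the backbone walk switched off). [cite: AizenmanDuminilCopinAnnals2021, arXiv:1912.07973 §4.2, proof of Lemma 4.4, bound on F₂ ("depleted coupling constants") (p. 12)] -/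
abbrev depletedGraph (D : Finset G.edgeFinset) : SimpleGraph V :=
  G.deleteEdges (↑(D.image fun e : G.edgeFinset => (e : Sym2 V)) : Set (Sym2 V))

/-- **The sourceless sum of the depleted graph is the sum with switched-off couplings**:
`Z_{G ∖ D}[B] = Z_{K off D}[B]`. [folklore] -/
theorem ecurrentSumIn_depletedGraph_eq (D : Finset G.edgeFinset) (B : Finset V) :
    ecurrentSumIn (depletedGraph D) K B = ecurrentSum (koff K D) B := by
  rw [ecurrentSum_koff]
  unfold ecurrentSumIn
  refine tsum_congr fun n => ?_
  by_cases h : (∀ e ∈ D, n e = 0) ∧ n.sources = B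
  · rw [if_pos ⟨(Current.isSupp_deleteEdges_iff' D n).2 h.1, h.2⟩, if_pos h]
  · rw [if_neg (fun h' => h ⟨(Current.isSupp_deleteEdges_iff' D n).1 h'.1, h'.2⟩), if_neg h]

namespace Current

variable {rk : G.edgeFinset → ℕ}

/-! ### The backbone decomposition: `∑_δ ρ(δ) Z_{G ∖ used(δ)}[∅] = Z[{u}Δ{y}]` -/

/-- **Total mass of the decomposition over the final states of the walk** (Aizenman 1982, eq. (9.8)
summed over the walks from `u` to `y`): `∑_{δ : walks u → y} ρ(δ) · Z_{K off used(δ)}[∅] = Z[{u}Δ{y}]`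
(the walk of a current with sources `{u}Δ{y}` and target `{y}` ends at `y`). [cite: AizenmanCMP1982, Prop. 9.2, eq. (9.8) and Lemma 9.2] -/
theorem sum_finalStates_patSum_mul_eq (hK : ∀ e, 0 ≤ K e) (hrk : Function.Injective rk) (u y : V) :
    ∑ δ ∈ finalStates rk ({y} : Finset V) u y, patSum K δ * ecurrentSum (koff K δ.used) ∅ =
      ecurrentSum K ({u} ∆ {y}) := by
  classical
  have h1 : ∀ δ ∈ finalStates rk ({y} : Finset V) u y, patSum K δ * ecurrentSum (koff K δ.used) ∅ =
      ∑' n : Current G, (if n.sources = {u} ∆ {y} then n.eweight K else 0) * (if InCyl δ n then 1 else 0) := by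
    intro δ hδ
    rw [tsum_inCyl_of_mem_finalStates hK hrk hδ ({u} ∆ {y}), symmDiff_self, Finset.bot_eq_empty]
  rw [Finset.sum_congr rfl h1,
    ← tsum_mul_indicator_pos_eq_sum hrk (fun n : Current G => if n.sources = {u} ∆ {y} then n.eweight K else 0) u y]
  unfold ecurrentSum
  refine tsum_congr fun n => ?_
  by_cases hs : n.sources = {u} ∆ {y}
  · rw [if_pos (explore_done_of_sources_eq hrk hs).2, mul_one]
  · rw [if_neg hs, zero_mul]

/-- **The conditioned sum over a cylinder**, for a functional of the off part read through the
depleted graph: for a final state `δ` (a walk `u → y`) and a sourceless companion `n₃`,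
`∑_{n₁ ∈ Cyl(δ), ∂n₁ = {u}Δ{y}} w(n₁) 𝟙[S_p ↔ S_q in (G ∖ used(Γ(n₁))) through (n₁ off Γ) + n₃]`
`= ρ(δ) · ∑_{r ⊆ E(G ∖ used(δ)), ∂r = ∅} w(r) 𝟙[S_p ↔ S_q in G ∖ used(δ) through r + n₃]`
("condition on `Γ(n₁)`. The remaining current in `n₁` is a sourceless current with depleted coupling
constants"). [cite: AizenmanDuminilCopinAnnals2021, arXiv:1912.07973 §4.2, proof of Lemma 4.4, bound on F₂ (p. 12)] -/
theorem tsum_inCyl_crossInInd_eq (hK : ∀ e, 0 ≤ K e) (hrk : Function.Injective rk) {u y : V}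
    {δ : XState G} (hδ : δ ∈ finalStates rk ({y} : Finset V) u y) (Sp Sq : Finset V) (n₃ : Current G) :
    ∑' n₁ : Current G, (if n₁.sources = {u} ∆ {y} then n₁.eweight K else 0) *
        crossInInd (depletedGraph (explore rk n₁ {y} u).used) Sp Sq
          (onEdges (explore rk n₁ {y} u).usedᶜ n₁ + n₃) * (if InCyl δ n₁ then 1 else 0) =
      patSum K δ * ∑' r : Current G,
        (if IsSupp (depletedGraph δ.used) r ∧ r.sources = ∅ then r.eweight K else 0) *
          crossInInd (depletedGraph δ.used) Sp Sq (r + n₃) := by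
  classical
  obtain ⟨hpos, n₀, hδ'⟩ := mem_finalStates_iff.1 hδ
  have h1 : ∀ n₁ : Current G, (if n₁.sources = {u} ∆ {y} then n₁.eweight K else 0) *
      crossInInd (depletedGraph (explore rk n₁ {y} u).used) Sp Sq
        (onEdges (explore rk n₁ {y} u).usedᶜ n₁ + n₃) * (if InCyl δ n₁ then 1 else 0) =
      (if n₁.sources = {u} ∆ {y} ∧ InCyl δ n₁ then n₁.eweight K else 0) *
        crossInInd (depletedGraph δ.used) Sp Sq (onEdges δ.usedᶜ n₁ + n₃) := by
    intro n₁
    by_cases hc : InCyl δ n₁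
    · have hc' : InCyl (explore rk n₀ {y} u) n₁ := by rw [← hδ']; exact hc
      have he : explore rk n₁ {y} u = δ := by rw [hδ']; exact (explore_eq_iff_inCyl hrk).2 hc'
      rw [he, if_pos hc, mul_one]
      by_cases hs : n₁.sources = {u} ∆ {y}
      · rw [if_pos hs, if_pos ⟨hs, hc⟩]
      · rw [if_neg hs, if_neg (fun h => hs h.1)]
    · rw [if_neg hc, mul_zero, if_neg (fun h => hc h.2), zero_mul]
  rw [tsum_congr h1,
    tsum_sources_inCyl_mul_eq hK hrk hδ' ({u} ∆ {y})
      (fun r => crossInInd (depletedGraph δ.used) Sp Sq (r + n₃)),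
    hpos, symmDiff_self, Finset.bot_eq_empty]
  congr 1
  refine tsum_congr fun r => ?_
  by_cases h : (∀ e ∈ δ.used, r e = 0) ∧ r.sources = ∅
  · rw [if_pos h, if_pos ⟨(isSupp_deleteEdges_iff' δ.used r).2 h.1, h.2⟩]
  · rw [if_neg h, if_neg (fun h' => h ⟨(isSupp_deleteEdges_iff' δ.used r).1 h'.1, h'.2⟩)]

section Metric

variable [PseudoMetricSpace V] {u : V}

/-! ### `F₁` and `F₄`: the zigzag and the two-passage chain rule -/

/-- **`F₁` forces a zigzag through the spheres**: if the walk (from `u`) is at distance `≥ n₀` and later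
at distance `≤ a ≤ n₀`, it is exactly on the sphere of radius `n₀` and later exactly on the sphere of
radius `a` ("the backbone `Γ(n₁)` must do a zigzag: to go from `0` to a vertex `v ∈ ∂Λ_n`, then to a
vertex `w ∈ ∂Λ_{ℓ_k}`"). [cite: AizenmanDuminilCopinAnnals2021, arXiv:1912.07973 §4.2, proof of Lemma 4.4, bound on F₁ (p. 12)] -/
theorem zigzagSets_of_fOne (hstep : ∀ v w, G.Adj v w → dist u w ≤ dist u v + 1)
    (hint : ∀ v, ∃ k : ℕ, dist u v = k) {n₁ : Current G} {y : V} {n₀ a : ℕ} (han : a ≤ n₀)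
    {S S' : Finset V} (hS : ∀ v, dist u v = n₀ → v ∈ S) (hS' : ∀ w, dist u w = a → w ∈ S')
    (h : FOne rk n₁ y u n₀ a) : ZigzagSets rk n₁ {y} u S S' := by
  obtain ⟨t₁, t₂, h12, h1, h2⟩ := h
  obtain ⟨s₁, s₂, hs, hs₁, hs₂⟩ := zigzag_spheres_of_return (rk := rk) (n := n₁) (Y := ({y} : Finset V))
    hstep hint u han (by rw [dist_self]; exact_mod_cast Nat.zero_le n₀) h12 h1 h2
  exact ⟨_, hS _ hs₁, _, hS' _ hs₂, s₁, s₂, hs, rfl, rfl⟩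

/-- `F₄` is `F₁` with the radii `(b, N₀)` in place of `(n₀, a)`. [cite: AizenmanDuminilCopinAnnals2021, arXiv:1912.07973 §4.2, proof of Lemma 4.4 ("The event F₄ is bounded similarly to F₁") (p. 12)] -/
theorem fFour_iff_fOne {n₁ : Current G} {y : V} {b N₀ : ℕ} :
    FFour rk n₁ y u b N₀ ↔ FOne rk n₁ y u b N₀ :=
  Iff.rfl

/-- **The bound on `F₁`** (and on `F₄`), single-current form:
`(∑ 1{∂n₁ = {u}Δ{y}} w(n₁) 𝟙[F₁]) · Z[∅]² ≤ ∑_{v ∈ S} ∑_{w ∈ S'} Z[{u}Δ{v}] Z[{v}Δ{w}] Z[{w}Δ{y}]`, i.e.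
"`P^{0x,∅}[F₁] ≤ ∑_{v ∈ ∂Λ_n, w ∈ ∂Λ_{ℓ_k}} ⟨σ₀σ_v⟩⟨σ_vσ_w⟩⟨σ_wσ_x⟩/⟨σ₀σ_x⟩`", for any sets `S`, `S'`
containing the spheres of radii `n₀` and `a ≤ n₀` about `u`. [cite: AizenmanDuminilCopinAnnals2021, arXiv:1912.07973 §4.2, proof of Lemma 4.4, display bounding P[F₁] (p. 12)] -/
theorem tsum_fOne_mul_le (hK : ∀ e, 0 ≤ K e) (hrk : Function.Injective rk)
    (hstep : ∀ v w, G.Adj v w → dist u w ≤ dist u v + 1) (hint : ∀ v, ∃ k : ℕ, dist u v = k)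
    (y : V) {n₀ a : ℕ} (han : a ≤ n₀) {S S' : Finset V} (hS : ∀ v, dist u v = n₀ → v ∈ S)
    (hS' : ∀ w, dist u w = a → w ∈ S') [DecidablePred fun n₁ : Current G => FOne rk n₁ y u n₀ a] :
    (∑' n₁ : Current G, (if n₁.sources = {u} ∆ {y} then n₁.eweight K else 0) *
        (if FOne rk n₁ y u n₀ a then 1 else 0)) * ecurrentSum K ∅ ^ 2 ≤
      ∑ v ∈ S, ∑ w ∈ S', ecurrentSum K ({u} ∆ {v}) * ecurrentSum K ({v} ∆ {w}) * ecurrentSum K ({w} ∆ {y}) := by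
  classical
  refine le_trans (mul_le_mul' (ENNReal.tsum_le_tsum fun n₁ => mul_le_mul' le_rfl ?_) le_rfl)
    (tsum_backboneZigzag_mem_mul_le hK hrk {y} u y S S')
  by_cases h : FOne rk n₁ y u n₀ a
  · rw [if_pos h, if_pos (zigzagSets_of_fOne hstep hint han hS hS' h)]
  · rw [if_neg h]; exact bot_le

/-- **The bound on `F₁`** (and on `F₄`), for the pair `(n₁, n₃)` under `P^{uy} ⊗ P^{∅}`:
`(∑ 1{∂n₁ = {u}Δ{y}} 1{∂n₃ = ∅} w w 𝟙[F₁(n₁)]) · Z[∅]² ≤ (∑_{v ∈ S} ∑_{w ∈ S'} Z[{u}Δ{v}] Z[{v}Δ{w}] Z[{w}Δ{y}]) · Z[∅]`.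
[cite: AizenmanDuminilCopinAnnals2021, arXiv:1912.07973 §4.2, proof of Lemma 4.4, display bounding P[F₁] (p. 12)] -/
theorem tsum_epairWeight_fOne_mul_le (hK : ∀ e, 0 ≤ K e) (hrk : Function.Injective rk)
    (hstep : ∀ v w, G.Adj v w → dist u w ≤ dist u v + 1) (hint : ∀ v, ∃ k : ℕ, dist u v = k)
    (y : V) {n₀ a : ℕ} (han : a ≤ n₀) {S S' : Finset V} (hS : ∀ v, dist u v = n₀ → v ∈ S)
    (hS' : ∀ w, dist u w = a → w ∈ S') [DecidablePred fun n₁ : Current G => FOne rk n₁ y u n₀ a] :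
    (∑' pr : Current G × Current G, epairWeight K ({u} ∆ {y}) ∅ pr *
        (if FOne rk pr.1 y u n₀ a then 1 else 0)) * ecurrentSum K ∅ ^ 2 ≤
      (∑ v ∈ S, ∑ w ∈ S', ecurrentSum K ({u} ∆ {v}) * ecurrentSum K ({v} ∆ {w}) * ecurrentSum K ({w} ∆ {y})) *
        ecurrentSum K ∅ := by
  have hprod : ∑' pr : Current G × Current G, epairWeight K ({u} ∆ {y}) ∅ pr *
      (if FOne rk pr.1 y u n₀ a then 1 else 0) =
      (∑' n₁ : Current G, (if n₁.sources = {u} ∆ {y} then n₁.eweight K else 0) *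
        (if FOne rk n₁ y u n₀ a then 1 else 0)) * ecurrentSum K ∅ := by
    unfold ecurrentSum
    rw [tsum_mul_tsum_eq_tsum_prod]
    refine tsum_congr fun pr => ?_
    rw [epairWeight_eq_mul]
    ring
  rw [hprod]
  calc (∑' n₁ : Current G, (if n₁.sources = {u} ∆ {y} then n₁.eweight K else 0) *
        (if FOne rk n₁ y u n₀ a then 1 else 0)) * ecurrentSum K ∅ * ecurrentSum K ∅ ^ 2
      = (∑' n₁ : Current G, (if n₁.sources = {u} ∆ {y} then n₁.eweight K else 0) *
        (if FOne rk n₁ y u n₀ a then 1 else 0)) * ecurrentSum K ∅ ^ 2 * ecurrentSum K ∅ := by ring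
    _ ≤ _ := mul_le_mul' (tsum_fOne_mul_le hK hrk hstep hint y han hS hS') le_rfl

/-! ### `F₂` and `F₃`: conditioning on the backbone and the depleted pair -/

/-- **On `F₂` the depleted pair connects the two spheres** (pointwise): `𝟙[F_band(p,q)(n₁, n₃)] ≤`
`𝟙[S_p ↔ S_q in G ∖ used(Γ(n₁)) through (n₁ off Γ(n₁)) + n₃]` for `S_p ⊇ {dist = p}`, `S_q ⊇ {dist = q}`.
[cite: AizenmanDuminilCopinAnnals2021, arXiv:1912.07973 §4.2, proof of Lemma 4.4, bound on F₂ ("The probability that some v ∈ ∂Λ_n and w ∈ ∂Λ_m are connected in ℤ⁴ ∖ Γ(n₁)") (p. 12)] -/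
theorem indicator_fBand_le_crossInInd {y : V} {p q : ℕ} {Sp Sq : Finset V}
    (hSp : ∀ v, dist u v = p → v ∈ Sp) (hSq : ∀ w, dist u w = q → w ∈ Sq) (n₁ n₃ : Current G)
    [Decidable (FBand rk n₁ n₃ y u p q)] :
    (if FBand rk n₁ n₃ y u p q then (1 : ℝ≥0∞) else 0) ≤
      crossInInd (depletedGraph (explore rk n₁ {y} u).used) Sp Sq
        (onEdges (explore rk n₁ {y} u).usedᶜ n₁ + n₃) := by
  classical
  split_ifs with h
  · obtain ⟨z, z', hz, hz', hreach⟩ := h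
    have hconn := connIn_of_avoidGraph_reachable (rk := rk) (u := u) n₃ hreach
    unfold crossInInd
    rw [if_pos ⟨z, hSp z hz, z', hSq z' hz', hconn⟩]
  · exact bot_le

/-- **The bound on `F₂`** (and on `F₃`), Aizenman–Duminil-Copin 2021, proof of Lemma 4.4: for the pair
`(n₁, n₃)` under `P^{uy} ⊗ P^{∅}` and radii `p`, `q`,
`(∑ 1{∂n₁ = {u}Δ{y}} 1{∂n₃ = ∅} w(n₁) w(n₃) 𝟙[F_band(p,q)]) · Z[∅] ≤ Z[{u}Δ{y}] · ∑_{v ∈ S_p} ∑_{w ∈ S_q} Z[{v}Δ{w}]²`,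
i.e. "`P^{0x,∅}[F₂] ≤ ∑_{v ∈ ∂Λ_n, w ∈ ∂Λ_m} ⟨σ_vσ_w⟩²`", for any sets `S_p ⊇ {dist(u,·) = p}`,
`S_q ⊇ {dist(u,·) = q}`. Proof as printed: condition on the backbone (cylinder decomposition over the
final states of the walk, which ends at `y`, and Aizenman's weight factorisation), bound the conditional
event by the connection of the two spheres through the depleted graph by the pair (depleted sourceless
current, `n₃`) — mass `≤ ∑ ⟨σ_vσ_w⟩'⟨σ_vσ_w⟩ Z'[∅] ≤ ∑ ⟨σ_vσ_w⟩² Z'[∅]` by the switching lemma and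
Griffiths — and resum `∑_δ ρ(δ) Z'_δ[∅] = Z[{u}Δ{y}]`. [cite: AizenmanDuminilCopinAnnals2021, arXiv:1912.07973 §4.2, proof of Lemma 4.4, display bounding P[F₂] (p. 12)] -/
theorem tsum_epairWeight_fBand_mul_le (hK : ∀ e, 0 ≤ K e) (hrk : Function.Injective rk) (y : V)
    (p q : ℕ) {Sp Sq : Finset V} (hSp : ∀ v, dist u v = p → v ∈ Sp) (hSq : ∀ w, dist u w = q → w ∈ Sq)
    [DecidablePred fun pr : Current G × Current G => FBand rk pr.1 pr.2 y u p q] :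
    (∑' pr : Current G × Current G, epairWeight K ({u} ∆ {y}) ∅ pr *
        (if FBand rk pr.1 pr.2 y u p q then 1 else 0)) * ecurrentSum K ∅ ≤
      ecurrentSum K ({u} ∆ {y}) * ∑ v ∈ Sp, ∑ w ∈ Sq, ecurrentSum K ({v} ∆ {w}) ^ 2 := by
  classical
  set A : Finset V := {u} ∆ {y}
  set FS := finalStates rk ({y} : Finset V) u y
  set B2 : ℝ≥0∞ := ∑ v ∈ Sp, ∑ w ∈ Sq, ecurrentSum K ({v} ∆ {w}) ^ 2
  -- Step 1 (pointwise): `𝟙[F₂] ≤ 𝟙[crossing of the depleted pair] · 𝟙[the walk ends at y]`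
  have hpt : ∀ pr : Current G × Current G,
      epairWeight K A ∅ pr * (if FBand rk pr.1 pr.2 y u p q then 1 else 0) ≤
        (if pr.2.sources = ∅ then pr.2.eweight K else 0) *
          ((if pr.1.sources = A then pr.1.eweight K else 0) *
            crossInInd (depletedGraph (explore rk pr.1 {y} u).used) Sp Sq
              (onEdges (explore rk pr.1 {y} u).usedᶜ pr.1 + pr.2) *
            (if (explore rk pr.1 {y} u).pos = y then 1 else 0)) := by
    intro pr
    by_cases hs : pr.1.sources = A
    · have hpos : (explore rk pr.1 {y} u).pos = y := (explore_done_of_sources_eq hrk hs).2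
      rw [epairWeight_eq_mul, if_pos hpos, mul_one]
      calc (if pr.1.sources = A then pr.1.eweight K else 0) * (if pr.2.sources = ∅ then pr.2.eweight K else 0) *
            (if FBand rk pr.1 pr.2 y u p q then 1 else 0)
          ≤ (if pr.1.sources = A then pr.1.eweight K else 0) * (if pr.2.sources = ∅ then pr.2.eweight K else 0) *
            crossInInd (depletedGraph (explore rk pr.1 {y} u).used) Sp Sq
              (onEdges (explore rk pr.1 {y} u).usedᶜ pr.1 + pr.2) :=
            mul_le_mul' le_rfl (indicator_fBand_le_crossInInd hSp hSq pr.1 pr.2)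
        _ = _ := by ring
    · have h0 : epairWeight K A ∅ pr = 0 := by
        unfold epairWeight
        rw [if_neg (fun h => hs h.1)]
      rw [h0, zero_mul]
      exact bot_le
  -- Step 2 (conditioning on the backbone): the dominating sum is `∑_δ ρ(δ) · T(δ)`, `T(δ)` the mass of
  -- the crossing for the pair (sourceless current of the depleted graph `G ∖ used(δ)`, `n₃`)
  have hdec : ∑' pr : Current G × Current G,
      (if pr.2.sources = ∅ then pr.2.eweight K else 0) *
        ((if pr.1.sources = A then pr.1.eweight K else 0) *
          crossInInd (depletedGraph (explore rk pr.1 {y} u).used) Sp Sq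
            (onEdges (explore rk pr.1 {y} u).usedᶜ pr.1 + pr.2) *
          (if (explore rk pr.1 {y} u).pos = y then 1 else 0)) =
      ∑ δ ∈ FS, patSum K δ * ∑' rn : Current G × Current G,
        (if IsSupp (depletedGraph δ.used) rn.1 ∧ rn.1.sources = ∅ then rn.1.eweight K else 0) *
          (if rn.2.sources = ∅ then rn.2.eweight K else 0) *
          crossInInd (depletedGraph δ.used) Sp Sq (rn.1 + rn.2) := by
    calc ∑' pr : Current G × Current G,
          (if pr.2.sources = ∅ then pr.2.eweight K else 0) *
            ((if pr.1.sources = A then pr.1.eweight K else 0) *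
              crossInInd (depletedGraph (explore rk pr.1 {y} u).used) Sp Sq
                (onEdges (explore rk pr.1 {y} u).usedᶜ pr.1 + pr.2) *
              (if (explore rk pr.1 {y} u).pos = y then 1 else 0))
        = ∑' n₁ : Current G, ∑' n₃ : Current G,
            (if n₃.sources = ∅ then n₃.eweight K else 0) *
              ((if n₁.sources = A then n₁.eweight K else 0) *
                crossInInd (depletedGraph (explore rk n₁ {y} u).used) Sp Sq
                  (onEdges (explore rk n₁ {y} u).usedᶜ n₁ + n₃) *
                (if (explore rk n₁ {y} u).pos = y then 1 else 0)) :=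
          ENNReal.tsum_prod (f := fun n₁ n₃ : Current G =>
            (if n₃.sources = ∅ then n₃.eweight K else 0) *
              ((if n₁.sources = A then n₁.eweight K else 0) *
                crossInInd (depletedGraph (explore rk n₁ {y} u).used) Sp Sq
                  (onEdges (explore rk n₁ {y} u).usedᶜ n₁ + n₃) *
                (if (explore rk n₁ {y} u).pos = y then 1 else 0)))
      _ = ∑' n₃ : Current G, ∑' n₁ : Current G,
            (if n₃.sources = ∅ then n₃.eweight K else 0) *
              ((if n₁.sources = A then n₁.eweight K else 0) *
                crossInInd (depletedGraph (explore rk n₁ {y} u).used) Sp Sq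
                  (onEdges (explore rk n₁ {y} u).usedᶜ n₁ + n₃) *
                (if (explore rk n₁ {y} u).pos = y then 1 else 0)) := ENNReal.tsum_comm
      _ = ∑' n₃ : Current G, (if n₃.sources = ∅ then n₃.eweight K else 0) *
            ∑ δ ∈ FS, patSum K δ * ∑' r : Current G,
              (if IsSupp (depletedGraph δ.used) r ∧ r.sources = ∅ then r.eweight K else 0) *
                crossInInd (depletedGraph δ.used) Sp Sq (r + n₃) := by
          refine tsum_congr fun n₃ => ?_
          rw [ENNReal.tsum_mul_left]
          congr 1
          rw [tsum_mul_indicator_pos_eq_sum hrk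
            (fun n₁ : Current G => (if n₁.sources = A then n₁.eweight K else 0) *
              crossInInd (depletedGraph (explore rk n₁ {y} u).used) Sp Sq
                (onEdges (explore rk n₁ {y} u).usedᶜ n₁ + n₃)) u y]
          refine Finset.sum_congr rfl fun δ hδ => ?_
          exact tsum_inCyl_crossInInd_eq hK hrk hδ Sp Sq n₃
      _ = ∑ δ ∈ FS, ∑' n₃ : Current G, (if n₃.sources = ∅ then n₃.eweight K else 0) *
            (patSum K δ * ∑' r : Current G,
              (if IsSupp (depletedGraph δ.used) r ∧ r.sources = ∅ then r.eweight K else 0) *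
                crossInInd (depletedGraph δ.used) Sp Sq (r + n₃)) := by
          simp_rw [Finset.mul_sum]
          exact Summable.tsum_finsetSum (fun _ _ => ENNReal.summable)
      _ = ∑ δ ∈ FS, patSum K δ * ∑' rn : Current G × Current G,
            (if IsSupp (depletedGraph δ.used) rn.1 ∧ rn.1.sources = ∅ then rn.1.eweight K else 0) *
              (if rn.2.sources = ∅ then rn.2.eweight K else 0) *
              crossInInd (depletedGraph δ.used) Sp Sq (rn.1 + rn.2) := by
          refine Finset.sum_congr rfl fun δ _ => ?_
          have hsum : ∀ n₃ : Current G, (if n₃.sources = ∅ then n₃.eweight K else 0) *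
              (patSum K δ * ∑' r : Current G,
                (if IsSupp (depletedGraph δ.used) r ∧ r.sources = ∅ then r.eweight K else 0) *
                  crossInInd (depletedGraph δ.used) Sp Sq (r + n₃)) =
              patSum K δ * ∑' r : Current G, (if n₃.sources = ∅ then n₃.eweight K else 0) *
                ((if IsSupp (depletedGraph δ.used) r ∧ r.sources = ∅ then r.eweight K else 0) *
                  crossInInd (depletedGraph δ.used) Sp Sq (r + n₃)) := by
            intro n₃
            rw [mul_left_comm, ← ENNReal.tsum_mul_left]
          rw [tsum_congr hsum, ENNReal.tsum_mul_left, ENNReal.tsum_comm, ← ENNReal.tsum_prod]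
          congr 1
          exact tsum_congr fun rn => by ring
  -- Step 3 (the depleted pair): `T(δ) · Z[∅] ≤ (∑ Z[vw]²) · Z_{K off used(δ)}[∅]`
  have hT : ∀ δ : XState G, (∑' rn : Current G × Current G,
      (if IsSupp (depletedGraph δ.used) rn.1 ∧ rn.1.sources = ∅ then rn.1.eweight K else 0) *
        (if rn.2.sources = ∅ then rn.2.eweight K else 0) *
        crossInInd (depletedGraph δ.used) Sp Sq (rn.1 + rn.2)) * ecurrentSum K ∅ ≤
      B2 * ecurrentSum (koff K δ.used) ∅ := by
    intro δ
    rw [← ecurrentSumIn_depletedGraph_eq]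
    exact tsum_isSupp_empty_empty_crossIn_mul_le (depletedGraph δ.used) hK Sp Sq
  -- Assembly
  calc (∑' pr : Current G × Current G, epairWeight K A ∅ pr *
        (if FBand rk pr.1 pr.2 y u p q then 1 else 0)) * ecurrentSum K ∅
      ≤ (∑' pr : Current G × Current G,
          (if pr.2.sources = ∅ then pr.2.eweight K else 0) *
            ((if pr.1.sources = A then pr.1.eweight K else 0) *
              crossInInd (depletedGraph (explore rk pr.1 {y} u).used) Sp Sq
                (onEdges (explore rk pr.1 {y} u).usedᶜ pr.1 + pr.2) *
              (if (explore rk pr.1 {y} u).pos = y then 1 else 0))) * ecurrentSum K ∅ :=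
        mul_le_mul' (ENNReal.tsum_le_tsum hpt) le_rfl
    _ = (∑ δ ∈ FS, patSum K δ * ∑' rn : Current G × Current G,
          (if IsSupp (depletedGraph δ.used) rn.1 ∧ rn.1.sources = ∅ then rn.1.eweight K else 0) *
            (if rn.2.sources = ∅ then rn.2.eweight K else 0) *
            crossInInd (depletedGraph δ.used) Sp Sq (rn.1 + rn.2)) * ecurrentSum K ∅ := by rw [hdec]
    _ = ∑ δ ∈ FS, patSum K δ * ((∑' rn : Current G × Current G,
          (if IsSupp (depletedGraph δ.used) rn.1 ∧ rn.1.sources = ∅ then rn.1.eweight K else 0) *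
            (if rn.2.sources = ∅ then rn.2.eweight K else 0) *
            crossInInd (depletedGraph δ.used) Sp Sq (rn.1 + rn.2)) * ecurrentSum K ∅) := by
        rw [Finset.sum_mul]
        refine Finset.sum_congr rfl fun δ _ => ?_
        ring
    _ ≤ ∑ δ ∈ FS, patSum K δ * (B2 * ecurrentSum (koff K δ.used) ∅) :=
        Finset.sum_le_sum fun δ _ => mul_le_mul' le_rfl (hT δ)
    _ = B2 * ∑ δ ∈ FS, patSum K δ * ecurrentSum (koff K δ.used) ∅ := by
        rw [Finset.mul_sum]
        refine Finset.sum_congr rfl fun δ _ => ?_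
        ring
    _ = ecurrentSum K A * B2 := by rw [sum_finalStates_patSum_mul_eq hK hrk u y, mul_comm]

end Metric

end Current

end Literature.Probability.LatticeModels
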